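import Mathlib.Analysis.InnerProductSpace.PiL2
import Mathlib.Analysis.SpecialFunctions.Complex.Arg
import Mathlib.Analysis.SpecialFunctions.Trigonometric.Inverse
import Mathlib.Combinatorics.SimpleGraph.DegreeSum
import Mathlib.Data.Set.Card
import Literature.Geometry.DiscreteGeometry.FejesTothKissingTwelve
import HarnessLib

/-!
# Nodes of the contact graph of a kissing configuration have degree at most four
# (Hales 2012, Lemma 7) — proved

Topic `Literature/Geometry/DiscreteGeometry`; provefact item for `Hales2012_kissingTwelve`
(sibling of `FejesTothKissingTwelve.lean`, which it imports).  That file vendors Hales's proof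
of Theorem 1 (Fejes Tóth's kissing-twelve conjecture) down to two computer-assisted named facts,
`flyspeck_L12` (Lemma 1) and `Hales2012_contactGraphFccOrHcp` (Theorem 3 with Lemmas 8–9: the
contact graph of every `V ∈ 𝒱` is the FCC or HCP contact graph).  Theorem 3 ("the contact
hypermap of `V ∈ 𝒱` has tame contact") is a list of ten properties (Definition 12); property 9
(node size `≤ 4`) is the pen-and-paper Lemma 7, which we PROVE here in graph form, bottom-up
towards Theorem 3:

* `IsKissingConfig.ncard_neighborSet_le_four`, `IsKissingConfig.degree_le_four`,
  `IsKissingConfig.maxDegree_le_four`: every vertex of `contactGraph S` has at most four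
  neighbours; `IsKissingConfig.card_edgeFinset_le`: hence at most `24` contact edges.

## Source

Hales, arXiv:1209.6043, p. 12: "**Lemma 7.** Let `V ∈ 𝒱`. Every node of `(V, E₂(V))` has degree
at most four. Furthermore, suppose the type of a node is `(p, q, 0)`. Then `(p, q)` must be
`(0, 3)`, `(1, 3)`, or `(2, 2)`. *Proof.* The interior angles of a spherical polygon in the contact
graph have the following lower `αₖ` and upper bounds `βₖ`, as a function of the number of sides
`k`: `α₃ = β₃ = dih(2,2,2,2,2,2)`; `α₄ = dih(2,2,2,2h₀,2,2)`, `β₄ = 2 dih(2,2,2,2,2h₀,2)`;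
`α_{≥5} = dih(2,2,2,2h₀,2,2)`, `β_{≥5} = 2π`. Thus, `p α₃ + q α₄ + r α₅ ≤ 2π ≤ p β₃ + q β₄ + r β₅`.
There are no solutions for `(p, q, r)` in natural numbers when `p + q + r ≥ 5` and only the three
given solutions in `(p, q, r)` with `r = 0`."  Only the first assertion (degree `≤ 4`, i.e. no
solutions with `p + q + r ≥ 5`) is formalised; the second concerns the faces of the planar
hypermap, which are not vendored.

## The proof formalised here

Fix a node `v` (`‖v‖ = 2`) and an orthonormal frame `b` of `ℝ³` with `b₂ = v/2` (Part C).  A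
neighbour `u` (`‖u‖ = 2`, `‖u − v‖ = 2`, so `⟪u, v⟫ = 2`) has coordinates `(X, Y, 1)` with
`X² + Y² = 3`; with `θ = arg (X + iY) ∈ (−π, π]` two neighbours satisfy
`‖u − u'‖² = 6 − 6 cos (θ − θ')` — the angle `θ − θ'` is Hales's dihedral angle `dih` along the
edge `{0, v}`.  Contact (`‖u − u'‖ = 2`) means `cos (θ − θ') = 1/3` (`α₃ = arccos (1/3)`, the
dihedral angle of the regular tetrahedron); separation (`‖u − u'‖ ≥ 2h₀`) means
`cos (θ − θ') ≤ 1 − (2h₀)²/6 = −0.0584` (`= cos α₄`).  Five neighbours, sorted by `θ`, give five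
cyclic gaps `≥ α₃` summing to `2π`, so each gap is `≤ 2π − 4α₃ ≤ π` and has cosine
`≥ cos 4α₃ = 17/81 > cos α₄`: every gap is a contact, all five equal `α₃`, and `5α₃ = 2π`
contradicts `cos 5α₃ = 241/243` (Parts A, B, D).  (Numerically: `α₃ ≈ 70.5°`, `α₄ ≈ 93.4°`,
`4α₃ + α₄ ≈ 375.5° > 360° > 5α₃ ≈ 352.6°`, as in Hales's table.)

## Contents (namespace `Literature.DiscreteGeom`)

* Part A: `cos_four_mul_arccos_third`, `cos_five_mul_arccos_third`, `pi_div_four_lt_arccos_third`.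
* Part B: `five_gaps_false`, `five_sorted_angles_false` (five directions on a circle).
* Part C: `exists_orthonormalBasis_third_eq`, `inner_eq_sum_three`, `mul_add_mul_eq_three_mul_cos`.
* Part D: `no_five_neighbours`, `card_le_four_of_neighbours`,
  `finite_and_ncard_le_four_of_neighbours` (pure `S²(2)` statements, no cardinality-twelve
  hypothesis).
* Part E: `IsKissingConfig.ncard_neighborSet_le_four`, `IsKissingConfig.degree_le_four`,
  `IsKissingConfig.maxDegree_le_four`, `IsKissingConfig.card_edgeFinset_le`.

## References

* T. C. Hales, *A proof of Fejes Tóth's conjecture on sphere packings with kissing number twelve*,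
  arXiv:1209.6043 (2012), Lemma 7, p. 12; Definition 12 (tame contact, property 9) and
  Theorem 3, pp. 11–12 (`Hales2012`).
-/

noncomputable section

namespace Literature.Geometry.DiscreteGeometry

open Real

/-! ### Part A. Trigonometric constants: `α = arccos (1/3)`, `cos 4α = 17/81`, `cos 5α = 241/243` -/

/-- `cos (2 · arccos (1/3)) = −7/9`. [folklore] -/
theorem cos_two_mul_arccos_third : cos (2 * arccos (1 / 3)) = -7 / 9 := by
  rw [cos_two_mul, cos_arccos (by norm_num) (by norm_num)]
  norm_num

/-- `cos (4 · arccos (1/3)) = 17/81`. [folklore] -/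
theorem cos_four_mul_arccos_third : cos (4 * arccos (1 / 3)) = 17 / 81 := by
  have h : 4 * arccos (1 / 3) = 2 * (2 * arccos (1 / 3)) := by ring
  rw [h, cos_two_mul, cos_two_mul_arccos_third]
  norm_num

/-- `sin² (arccos (1/3)) = 8/9`. [folklore] -/
theorem sin_sq_arccos_third : sin (arccos (1 / 3)) ^ 2 = 8 / 9 := by
  rw [sin_sq, cos_arccos (by norm_num) (by norm_num)]
  norm_num

/-- `cos (5 · arccos (1/3)) = 241/243 ≠ 1`: five dihedral angles of the regular tetrahedron do
not close up around an edge. [folklore] -/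
theorem cos_five_mul_arccos_third : cos (5 * arccos (1 / 3)) = 241 / 243 := by
  set a := arccos (1 / 3) with ha
  have hc : cos a = 1 / 3 := cos_arccos (by norm_num) (by norm_num)
  have hs : sin a ^ 2 = 8 / 9 := sin_sq_arccos_third
  have h2 : cos (2 * a) = -7 / 9 := cos_two_mul_arccos_third
  have h4 : cos (4 * a) = 17 / 81 := cos_four_mul_arccos_third
  have hs4 : sin (4 * a) * sin a = 4 * sin a ^ 2 * cos a * cos (2 * a) := by
    have e4 : 4 * a = 2 * (2 * a) := by ring
    rw [e4, sin_two_mul, sin_two_mul]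
    ring
  have e5 : 5 * a = 4 * a + a := by ring
  rw [e5, cos_add, h4, hs4, hs, hc, h2]
  norm_num

/-- `π/4 < arccos (1/3)` (as `1/3 < √2/2`). [folklore] -/
theorem pi_div_four_lt_arccos_third : π / 4 < arccos (1 / 3) := by
  rw [← not_le, arccos_le_pi_div_four, not_le]
  rw [show (1 : ℝ) / 3 = √(1 / 9) by
    rw [show (1 : ℝ) / 9 = (1 / 3) ^ 2 by norm_num, sqrt_sq (by norm_num)]]
  rw [show √2 / 2 = √(1 / 2) by rw [sqrt_div_self', one_div, ← inv_eq_one_div]; simp [sqrt_inv]]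
  exact sqrt_lt_sqrt (by norm_num) (by norm_num)

/-- A nonnegative angle whose cosine is `≤ 1/3` is at least `arccos (1/3)`. [folklore] -/
theorem arccos_third_le_of_cos_le {g : ℝ} (h0 : 0 ≤ g) (hc : cos g ≤ 1 / 3) :
    arccos (1 / 3) ≤ g := by
  by_cases hg : g ≤ π
  · calc arccos (1 / 3) ≤ arccos (cos g) := arccos_le_arccos hc
      _ = g := arccos_cos h0 hg
  · exact (arccos_le_pi _).trans (le_of_lt (not_le.1 hg))

/-! ### Part B. Five gaps around a circle -/

/-- **No five gaps.** Five nonnegative angles summing to `2π`, each with cosine `≤ 1/3` and each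
either with cosine exactly `1/3` (a contact triangle) or with cosine `≤ σ < 17/81` (a separated
pair), do not exist: each is `≥ α = arccos (1/3)`, hence `≤ 2π − 4α ≤ π`, so its cosine is
`≥ cos 4α = 17/81 > σ` and it equals `α`; but `5α ≠ 2π` since `cos 5α = 241/243`. [folklore] -/
theorem five_gaps_false {σ : ℝ} (hσ : σ < 17 / 81) (g : Fin 5 → ℝ) (h0 : ∀ k, 0 ≤ g k)
    (hsum : g 0 + g 1 + g 2 + g 3 + g 4 = 2 * π) (hc : ∀ k, cos (g k) ≤ 1 / 3)
    (hd : ∀ k, cos (g k) = 1 / 3 ∨ cos (g k) ≤ σ) : False := by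
  set α := arccos (1 / 3) with hα
  have hlow : ∀ k, α ≤ g k := fun k => arccos_third_le_of_cos_le (h0 k) (hc k)
  have hpi4 : π / 4 < α := pi_div_four_lt_arccos_third
  have hup : ∀ k, g k ≤ 2 * π - 4 * α := by
    intro k
    have h0' := hlow 0; have h1' := hlow 1; have h2' := hlow 2; have h3' := hlow 3
    have h4' := hlow 4
    fin_cases k <;> simp only [Fin.zero_eta, Fin.mk_one, Fin.reduceFinMk] <;> linarith
  have heq : ∀ k, g k = α := by
    intro k
    have hk1 : g k ≤ π := by linarith [hup k]
    have hcos : 17 / 81 ≤ cos (g k) := by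
      rw [← cos_four_mul_arccos_third, ← cos_two_pi_sub]
      exact cos_le_cos_of_nonneg_of_le_pi (h0 k) (by linarith) (hup k)
    have h13 : cos (g k) = 1 / 3 := by
      rcases hd k with h | h
      · exact h
      · exact absurd (hcos.trans h) (not_le.2 hσ)
    rw [← arccos_cos (h0 k) hk1, h13]
  have h5 : 5 * α = 2 * π := by
    have := hsum
    rw [heq 0, heq 1, heq 2, heq 3, heq 4] at this
    linarith
  have : cos (5 * α) = 1 := by rw [h5, cos_two_pi]
  rw [hα, cos_five_mul_arccos_third] at this
  norm_num at this

/-- **No five sorted directions.** Five angles `−π < t₀ < t₁ < ⋯ < t₄ ≤ π` such that every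
difference `tᵢ − tⱼ` (`i ≠ j`) has cosine `≤ 1/3`, and cosine `= 1/3` or `≤ σ < 17/81`, do not
exist (apply `five_gaps_false` to the four consecutive gaps and the wrap-around gap
`2π − (t₄ − t₀)`). [folklore] -/
theorem five_sorted_angles_false {σ : ℝ} (hσ : σ < 17 / 81) (t : Fin 5 → ℝ) (hmono : StrictMono t)
    (hlo : -π < t 0) (hhi : t 4 ≤ π)
    (hC : ∀ i j, i ≠ j →
      cos (t i - t j) ≤ 1 / 3 ∧ (cos (t i - t j) = 1 / 3 ∨ cos (t i - t j) ≤ σ)) : False := by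
  have h01 : t 0 < t 1 := hmono (by decide)
  have h12 : t 1 < t 2 := hmono (by decide)
  have h23 : t 2 < t 3 := hmono (by decide)
  have h34 : t 3 < t 4 := hmono (by decide)
  have hw : cos (2 * π - (t 4 - t 0)) = cos (t 4 - t 0) := cos_two_pi_sub _
  refine five_gaps_false hσ ![t 1 - t 0, t 2 - t 1, t 3 - t 2, t 4 - t 3, 2 * π - (t 4 - t 0)]
    ?_ ?_ ?_ ?_
  · intro k
    fin_cases k <;> simp <;> linarith
  · simp only [Matrix.cons_val_zero, Matrix.cons_val_one, Matrix.cons_val]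
    ring
  · intro k
    fin_cases k
    · simpa using (hC 1 0 (by decide)).1
    · simpa using (hC 2 1 (by decide)).1
    · simpa using (hC 3 2 (by decide)).1
    · simpa using (hC 4 3 (by decide)).1
    · simpa [hw] using (hC 4 0 (by decide)).1
  · intro k
    fin_cases k
    · simpa using (hC 1 0 (by decide)).2
    · simpa using (hC 2 1 (by decide)).2
    · simpa using (hC 3 2 (by decide)).2
    · simpa using (hC 4 3 (by decide)).2
    · simpa [hw] using (hC 4 0 (by decide)).2

/-! ### Part C. Tangent coordinates at a point of `S²(2)` -/

open RealInnerProductSpace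

/-- An orthonormal basis of `ℝ³` whose third vector is `v/2`, for `‖v‖ = 2`. [folklore] -/
theorem exists_orthonormalBasis_third_eq {v : EuclideanSpace ℝ (Fin 3)} (hv : ‖v‖ = 2) :
    ∃ b : OrthonormalBasis (Fin 3) ℝ (EuclideanSpace ℝ (Fin 3)), b 2 = (1 / 2 : ℝ) • v := by
  have hcard : Module.finrank ℝ (EuclideanSpace ℝ (Fin 3)) = Fintype.card (Fin 3) := by
    rw [finrank_euclideanSpace_fin, Fintype.card_fin]
  haveI : Subsingleton (↥({2} : Set (Fin 3))) :=
    (Set.subsingleton_coe _).2 Set.subsingleton_singleton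
  have hon : Orthonormal ℝ (({2} : Set (Fin 3)).restrict fun _ : Fin 3 => (1 / 2 : ℝ) • v) := by
    rw [orthonormal_subsingleton_iff]
    intro i
    simp only [Set.restrict_apply, norm_smul, hv]
    norm_num
  obtain ⟨b, hb⟩ := Orthonormal.exists_orthonormalBasis_extension_of_card_eq hcard hon
  exact ⟨b, hb 2 rfl⟩

/-- Two points of `S²(2)` at distance `2` have inner product `2`. [folklore] -/
theorem inner_eq_two_of_dist_eq_two {u v : EuclideanSpace ℝ (Fin 3)} (hu : ‖u‖ = 2) (hv : ‖v‖ = 2)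
    (h : dist u v = 2) : ⟪u, v⟫ = 2 := by
  have h1 : ‖u - v‖ ^ 2 = 4 := by rw [← dist_eq_norm, h]; norm_num
  rw [norm_sub_sq_real, hu, hv] at h1
  linarith

/-- Expansion of the inner product in an orthonormal basis of `ℝ³`. [folklore] -/
theorem inner_eq_sum_three (b : OrthonormalBasis (Fin 3) ℝ (EuclideanSpace ℝ (Fin 3)))
    (u w : EuclideanSpace ℝ (Fin 3)) :
    ⟪u, w⟫ = ⟪b 0, u⟫ * ⟪b 0, w⟫ + ⟪b 1, u⟫ * ⟪b 1, w⟫ + ⟪b 2, u⟫ * ⟪b 2, w⟫ := by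
  rw [← b.sum_inner_mul_inner u w, Fin.sum_univ_three, real_inner_comm u (b 0),
    real_inner_comm u (b 1), real_inner_comm u (b 2)]

/-- A vector of `ℝ³` is determined by its three coordinates in an orthonormal basis. [folklore] -/
theorem eq_of_inner_basis_eq (b : OrthonormalBasis (Fin 3) ℝ (EuclideanSpace ℝ (Fin 3)))
    {u w : EuclideanSpace ℝ (Fin 3)}
    (h : ∀ i, ⟪b i, u⟫ = ⟪b i, w⟫) : u = w := by
  rw [← b.sum_repr' u, ← b.sum_repr' w]
  exact Finset.sum_congr rfl fun i _ => by rw [h i]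

/-- **Polar form in the tangent plane.** If `X² + Y² = 3` and `θ = arg (X + iY)`, then
`X = √3 cos θ` and `Y = √3 sin θ`. [folklore] -/
theorem eq_sqrt_three_mul_cos_sin_arg {X Y : ℝ} (h : X ^ 2 + Y ^ 2 = 3) :
    X = √3 * cos (Complex.arg ⟨X, Y⟩) ∧ Y = √3 * sin (Complex.arg ⟨X, Y⟩) := by
  have hn : ‖(⟨X, Y⟩ : ℂ)‖ = √3 := by
    rw [Complex.norm_def, Complex.normSq_mk, ← h]
    congr 1
    ring
  refine ⟨?_, ?_⟩
  · have := Complex.norm_mul_cos_arg ⟨X, Y⟩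
    rw [hn] at this
    exact this.symm
  · have := Complex.norm_mul_sin_arg ⟨X, Y⟩
    rw [hn] at this
    exact this.symm

/-- Hence `X X' + Y Y' = 3 cos (θ − θ')` for two tangent vectors of squared length `3`.
[folklore] -/
theorem mul_add_mul_eq_three_mul_cos {X Y X' Y' : ℝ} (h : X ^ 2 + Y ^ 2 = 3)
    (h' : X' ^ 2 + Y' ^ 2 = 3) :
    X * X' + Y * Y' = 3 * cos (Complex.arg ⟨X, Y⟩ - Complex.arg ⟨X', Y'⟩) := by
  set θ := Complex.arg ⟨X, Y⟩ with hθ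
  set θ' := Complex.arg ⟨X', Y'⟩ with hθ'
  obtain ⟨hX, hY⟩ := eq_sqrt_three_mul_cos_sin_arg h
  obtain ⟨hX', hY'⟩ := eq_sqrt_three_mul_cos_sin_arg h'
  rw [← hθ] at hX hY
  rw [← hθ'] at hX' hY'
  have h3 : √3 * √3 = 3 := Real.mul_self_sqrt (by norm_num)
  rw [cos_sub]
  linear_combination X' * hX + √3 * cos θ * hX' + cos θ * cos θ' * h3 + Y' * hY +
    √3 * sin θ * hY' + sin θ * sin θ' * h3

/-! ### Part D. No five neighbours -/

/-- `1 − (2h₀)²/6 = −0.0584 < 17/81`: the cosine of the tangent angle of a separated pair of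
neighbours is below `cos (4 arccos (1/3))`. [folklore] -/
theorem one_sub_sq_two_mul_h0_div_six_lt : 1 - (2 * hales_h0) ^ 2 / 6 < 17 / 81 := by
  rw [hales_h0_eq]; norm_num

/-- **No point of `S²(2)` has five neighbours** at distance exactly `2` whose pairwise distances
are all `2` or `≥ 2h₀`.  Proof: in an orthonormal frame with third vector `v/2` each neighbour is
`(X, Y, 1)` with `X² + Y² = 3`; with `θ = arg (X + iY)` one has `‖u − u'‖² = 6 − 6 cos (θ − θ')`,
so sorting the five angles contradicts `five_sorted_angles_false`.
[cite: Hales2012, Lemma 7 (proof)] -/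
theorem no_five_neighbours {v : EuclideanSpace ℝ (Fin 3)} (hv : ‖v‖ = 2)
    (u : Fin 5 → EuclideanSpace ℝ (Fin 3))
    (hinj : Function.Injective u) (hn : ∀ k, ‖u k‖ = 2) (hd : ∀ k, dist (u k) v = 2)
    (hsep : ∀ i j, i ≠ j → dist (u i) (u j) = 2 ∨ 2 * hales_h0 ≤ dist (u i) (u j)) : False := by
  obtain ⟨b, hb⟩ := exists_orthonormalBasis_third_eq hv
  -- tangent coordinates
  set X : Fin 5 → ℝ := fun k => ⟪b 0, u k⟫ with hXdef
  set Y : Fin 5 → ℝ := fun k => ⟪b 1, u k⟫ with hYdef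
  have hZ : ∀ k, ⟪b 2, u k⟫ = 1 := by
    intro k
    rw [hb, real_inner_smul_left, real_inner_comm,
      inner_eq_two_of_dist_eq_two (hn k) hv (hd k)]
    norm_num
  have hXY : ∀ k, X k ^ 2 + Y k ^ 2 = 3 := by
    intro k
    have h4 : ⟪u k, u k⟫ = 4 := by
      rw [real_inner_self_eq_norm_sq, hn k]; norm_num
    rw [inner_eq_sum_three b, hZ k] at h4
    simp only [hXdef, hYdef]
    nlinarith [h4]
  set θ : Fin 5 → ℝ := fun k => Complex.arg ⟨X k, Y k⟩ with hθdef
  have hdist : ∀ i j, dist (u i) (u j) ^ 2 = 6 - 6 * cos (θ i - θ j) := by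
    intro i j
    have hc := mul_add_mul_eq_three_mul_cos (hXY i) (hXY j)
    rw [dist_eq_norm, norm_sub_sq_real, hn i, hn j, inner_eq_sum_three b, hZ i, hZ j]
    simp only [hθdef]
    linarith [hc]
  have hθinj : Function.Injective θ := by
    intro i j hij
    apply hinj
    obtain ⟨hXi, hYi⟩ := eq_sqrt_three_mul_cos_sin_arg (hXY i)
    obtain ⟨hXj, hYj⟩ := eq_sqrt_three_mul_cos_sin_arg (hXY j)
    have hij' : Complex.arg ⟨X i, Y i⟩ = Complex.arg ⟨X j, Y j⟩ := hij
    refine eq_of_inner_basis_eq b fun m => ?_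
    fin_cases m
    · show X i = X j
      rw [hXi, hXj, hij']
    · show Y i = Y j
      rw [hYi, hYj, hij']
    · simp only [Fin.reduceFinMk, hZ]
  -- the pairwise constraints in terms of angles
  have hC : ∀ i j, i ≠ j → cos (θ i - θ j) ≤ 1 / 3 ∧
      (cos (θ i - θ j) = 1 / 3 ∨ cos (θ i - θ j) ≤ 1 - (2 * hales_h0) ^ 2 / 6) := by
    intro i j hij
    have hsq := hdist i j
    rcases hsep i j hij with h | h
    · rw [h] at hsq
      exact ⟨by linarith, Or.inl (by linarith)⟩
    · have h0 : 0 ≤ 2 * hales_h0 := by rw [hales_h0_eq]; norm_num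
      have h2 : (2 * hales_h0) ^ 2 ≤ dist (u i) (u j) ^ 2 := pow_le_pow_left₀ h0 h 2
      have h252 : (2 : ℝ) ^ 2 ≤ (2 * hales_h0) ^ 2 := by rw [hales_h0_eq]; norm_num
      rw [hsq] at h2
      refine ⟨by linarith, Or.inr ?_⟩
      linarith
  -- sort the five angles
  have hAcard : (Finset.univ.image θ).card = 5 := by
    rw [Finset.card_image_of_injective _ hθinj, Finset.card_univ, Fintype.card_fin]
  let e := (Finset.univ.image θ).orderEmbOfFin hAcard
  have hmem : ∀ k, ∃ i, θ i = e k := by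
    intro k
    have := (Finset.univ.image θ).orderEmbOfFin_mem hAcard k
    rw [Finset.mem_image] at this
    obtain ⟨i, -, hi⟩ := this
    exact ⟨i, hi⟩
  choose π' hπ' using hmem
  refine five_sorted_angles_false one_sub_sq_two_mul_h0_div_six_lt (fun k => e k) e.strictMono
    ?_ ?_ ?_
  · show -π < e 0
    rw [← hπ' 0]
    exact Complex.neg_pi_lt_arg _
  · show e 4 ≤ π
    rw [← hπ' 4]
    exact Complex.arg_le_pi _
  · intro i j hij
    have hne : π' i ≠ π' j := by
      intro h
      apply hij
      apply e.injective
      rw [← hπ' i, ← hπ' j, h]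
    rw [← hπ' i, ← hπ' j]
    exact hC _ _ hne

/-- **At most four neighbours (finite-set form).** If every point of the finite set `F ⊂ S²(2)`
is at distance `2` from `v ∈ S²(2)`, and any two distinct points of `F` are at distance `2` or
`≥ 2h₀`, then `|F| ≤ 4`. [cite: Hales2012, Lemma 7] -/
theorem card_le_four_of_neighbours {v : EuclideanSpace ℝ (Fin 3)} (hv : ‖v‖ = 2)
    {F : Finset (EuclideanSpace ℝ (Fin 3))}
    (hn : ∀ u ∈ F, ‖u‖ = 2) (hd : ∀ u ∈ F, dist u v = 2)
    (hsep : ∀ u ∈ F, ∀ w ∈ F, u ≠ w → dist u w = 2 ∨ 2 * hales_h0 ≤ dist u w) :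
    F.card ≤ 4 := by
  by_contra h
  obtain ⟨F', hF', hcard⟩ := Finset.exists_subset_card_eq (show 5 ≤ F.card by omega)
  set e := (Finset.equivFinOfCardEq hcard).symm with he
  refine no_five_neighbours hv (fun k => ((e k : F') : EuclideanSpace ℝ (Fin 3)))
    (Subtype.val_injective.comp e.injective) (fun k => hn _ (hF' (e k).2))
    (fun k => hd _ (hF' (e k).2)) fun i j hij => hsep _ (hF' (e i).2) _ (hF' (e j).2) ?_
  exact fun h => hij (e.injective (Subtype.val_injective h))

/-- **At most four neighbours (set form).** Under the same hypotheses an arbitrary set `T` is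
finite with `T.ncard ≤ 4`. [cite: Hales2012, Lemma 7] -/
theorem finite_and_ncard_le_four_of_neighbours {v : EuclideanSpace ℝ (Fin 3)} (hv : ‖v‖ = 2)
    {T : Set (EuclideanSpace ℝ (Fin 3))}
    (hn : ∀ u ∈ T, ‖u‖ = 2) (hd : ∀ u ∈ T, dist u v = 2)
    (hsep : ∀ u ∈ T, ∀ w ∈ T, u ≠ w → dist u w = 2 ∨ 2 * hales_h0 ≤ dist u w) :
    T.Finite ∧ T.ncard ≤ 4 := by
  have key : ∀ F : Finset (EuclideanSpace ℝ (Fin 3)),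
      (↑F : Set (EuclideanSpace ℝ (Fin 3))) ⊆ T → F.card ≤ 4 := fun F hF =>
    card_le_four_of_neighbours hv (fun u hu => hn u (hF hu)) (fun u hu => hd u (hF hu))
      fun u hu w hw => hsep u (hF hu) w (hF hw)
  have hfin : T.Finite := by
    by_contra hinf
    obtain ⟨t, ht, htfin, htcard⟩ := Set.Infinite.exists_subset_ncard_eq hinf 5
    have h4 := key htfin.toFinset (by simpa using ht)
    rw [Set.ncard_eq_toFinset_card t htfin] at htcard
    omega
  refine ⟨hfin, ?_⟩
  rw [Set.ncard_eq_toFinset_card T hfin]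
  exact key _ (by simp)

/-! ### Part E. Hales 2012, Lemma 7: node degrees of the contact graph -/

/-- **Hales 2012, Lemma 7 (first assertion): "Let `V ∈ 𝒱`. Every node of `(V, E₂(V))` has
degree at most four."**  For a kissing configuration `S` (Definition 1: twelve points of `S²(2)`
with pairwise distances `2` or `≥ 2h₀`), every vertex of the contact graph has at most four
neighbours.  Hales's proof: the angles of the faces around a node are `α₃ = dih(2,2,2,2,2,2)` for
a triangle and `≥ α₄ = dih(2,2,2,2h₀,2,2)` otherwise, and `p α₃ + q α₄ + r α₅ ≤ 2π ≤ p β₃ + ⋯`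
has no solution with `p + q + r ≥ 5`; here: five tangent directions would have consecutive gaps
`= α₃ = arccos (1/3)` or `≥ α₄ = arccos (1 − (2h₀)²/6)`, forcing all five gaps to be `α₃`
(`cos 4α₃ = 17/81 > cos α₄`) and `5α₃ = 2π`, contradicting `cos 5α₃ = 241/243`.
[cite: Hales2012, Lemma 7] -/
theorem IsKissingConfig.ncard_neighborSet_le_four {S : Set (EuclideanSpace ℝ (Fin 3))}
    (hS : IsKissingConfig S) (v : S) :
    ((contactGraph S).neighborSet v).ncard ≤ 4 := by
  have h := (finite_and_ncard_le_four_of_neighbours (v := (v : EuclideanSpace ℝ (Fin 3)))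
    (T := Subtype.val '' (contactGraph S).neighborSet v) (hS.norm_eq v.2) ?_ ?_ ?_).2
  · rwa [Set.ncard_image_of_injective _ Subtype.val_injective] at h
  · rintro _ ⟨u, -, rfl⟩
    exact hS.norm_eq u.2
  · rintro _ ⟨u, hu, rfl⟩
    rw [SimpleGraph.mem_neighborSet, contactGraph_adj] at hu
    rwa [dist_comm]
  · rintro _ ⟨u, -, rfl⟩ _ ⟨w, -, rfl⟩ hne
    rcases hS.2.2 u u.2 w w.2 with h | h | h
    · exact absurd h hne
    · exact Or.inl h
    · exact Or.inr h

/-- **Hales 2012, Lemma 7, degree form**: every node of the contact graph of a kissing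
configuration has degree `≤ 4`. [cite: Hales2012, Lemma 7] -/
theorem IsKissingConfig.degree_le_four {S : Set (EuclideanSpace ℝ (Fin 3))}
    (hS : IsKissingConfig S) (v : S)
    [Fintype ((contactGraph S).neighborSet v)] : (contactGraph S).degree v ≤ 4 := by
  rw [← SimpleGraph.card_neighborSet_eq_degree, ← Nat.card_eq_fintype_card, Nat.card_coe_set_eq]
  exact hS.ncard_neighborSet_le_four v

/-- Hence the maximum degree of the contact graph is `≤ 4`. [cite: Hales2012, Lemma 7] -/
theorem IsKissingConfig.maxDegree_le_four {S : Set (EuclideanSpace ℝ (Fin 3))}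
    (hS : IsKissingConfig S) [Fintype S]
    [DecidableRel (contactGraph S).Adj] : (contactGraph S).maxDegree ≤ 4 :=
  (contactGraph S).maxDegree_le_of_forall_degree_le 4 fun v => hS.degree_le_four v

/-- Hence, by the handshake lemma, a kissing configuration has at most `12 · 4 / 2 = 24` contacts
(the FCC and HCP configurations have exactly `24`) — an immediate corollary of Lemma 7, not stated
in the source. [folklore] -/
theorem IsKissingConfig.card_edgeFinset_le {S : Set (EuclideanSpace ℝ (Fin 3))}
    (hS : IsKissingConfig S) [Fintype S]
    [DecidableRel (contactGraph S).Adj] : (contactGraph S).edgeFinset.card ≤ 24 := by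
  have h1 := (contactGraph S).sum_degrees_eq_twice_card_edges
  have h2 : ∑ v, (contactGraph S).degree v ≤ ∑ _v : S, 4 :=
    Finset.sum_le_sum fun v _ => hS.degree_le_four v
  have h3 : Fintype.card S = 12 := by
    rw [← Nat.card_eq_fintype_card, Nat.card_coe_set_eq, hS.ncard_eq]
  simp only [Finset.sum_const, Finset.card_univ, h3, smul_eq_mul] at h2
  omega

end Literature.Geometry.DiscreteGeometry
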